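import Summits.CriticalPhenomena.PercolationContinuityZ3.Theorems.PercNearOneGluingNoHeavyQuantRootReduction
import HarnessLib

/-!
# QUANT lane R8, FAR on general trees — the SIZE-BIASED two-point decomposition: every count law of mean `μ ≤ 1` is a
# mixture of heavy blocks `{0, r; μ/r}` with credit `μ` (the free row of README V186 (4) / LEAD-NOTES-G15 N26 (5))

builds on p205010 (kernel theorem, internal audit signed; external expert review pending)

Support file (`--supports stmt-CriticalPhenomena-4575`), QUANT lane typer seat prim-quant-stmt (gen 17), rung R8 of
`run/shared/lean/prim/quant/LADDER.md`.  Theorems only, no sorries, standard axioms.  Vocabulary of `…QuantRootReduction`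
(two-point laws `TP[lo, hi, g] = g·δ_hi + (1 − g)·δ_lo`).

**The decomposition** (lead g15).  A law `ν` on `{0, …, n}` with mean `μ = Σ_r r·ν r ≠ 0` satisfies, for every `h ≤ n`,
`ν h = Σ_{r=0}^{n} (r·ν r/μ) · TP[0, r, μ/r](h)` (`twoPoint_sizeBiased`): the size-biased mixture of the single blocks
`{0, r; μ/r}`.  The weights `r·ν r/μ` sum to `1` (`sizeBiased_weights_sum`) and are `≥ 0` when `ν ≥ 0`, `μ > 0`; the component
`r ≥ 1` is a blob of size `r` behind the gate `μ/r ∈ [μ/n, μ]`, so it is a probability when `μ ≤ 1`, it is HEAVY at every floor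
`x ≤ μ/n` — automatic for a tree side structure with `n` relays of marginal `≥ x` each — and its credit `r·(μ/r) = μ` is the mean
(`sizeBiased_credit`).  Hence every structure of conditional mean `≤ 1` meets the hypotheses of `Quant.RootDec.rtail_ge_of_heavyDec`
with `cr = μ` (and of p1 g10's mean-preserving mixture principle); the threshold `1` is sharp for general laws (README V186 (4):
the gated law `{unit 0.7, pair 0.4}` of mean `1.2` is not admissible).

[this work]; the gluing rows served [cite: KozmaNitzan2024, Conjecture 3 (p. 15)].
-/

namespace Summit.CriticalPhenomena.PercolationContinuityZ3.Theorems

namespace Quant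

namespace RootDec

open Finset

/-- the two-point law `{lo, hi; g}` (as in `…QuantRootReduction`) -/
local notation3 "TP[" lo ", " hi ", " g ", " h "]" =>
  (g : ℝ) * (if (h : ℕ) = (hi : ℕ) then (1 : ℝ) else 0) + (1 - (g : ℝ)) * (if (h : ℕ) = (lo : ℕ) then (1 : ℝ) else 0)

/-- The size-biased weights sum to one: `Σ_{r ≤ n} r·ν r/μ = 1` for `μ = Σ_{r ≤ n} r·ν r ≠ 0`. [this work] -/
theorem sizeBiased_weights_sum (ν : ℕ → ℝ) (n : ℕ) (μ : ℝ) (hμ : μ = ∑ r ∈ Finset.range (n + 1), (r : ℝ) * ν r)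
    (hμ0 : μ ≠ 0) : ∑ r : Fin (n + 1), ((r : ℕ) : ℝ) * ν r / μ = 1 := by
  rw [Fin.sum_univ_eq_sum_range (fun r => (r : ℝ) * ν r / μ) (n + 1), ← Finset.sum_div, ← hμ, div_self hμ0]

/-- The credit of the size-biased component `r ≥ 1` is the mean: `(r − 0)·(μ/r) = μ`. [this work] -/
theorem sizeBiased_credit (μ : ℝ) (r : ℕ) (hr : r ≠ 0) : 2 * ((0 : ℕ) : ℝ) + (((r : ℕ) : ℝ) - ((0 : ℕ) : ℝ)) * (μ / r) = μ := by
  have hr' : (r : ℝ) ≠ 0 := Nat.cast_ne_zero.2 hr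
  rw [Nat.cast_zero, mul_zero, zero_add, sub_zero, mul_div_cancel₀ _ hr']

/-- **The size-biased two-point decomposition.**  For a law `ν` on `{0, …, n}` (`Σ_{h ≤ n} ν h = 1`) with mean
`μ = Σ_{r ≤ n} r·ν r ≠ 0`: `ν h = Σ_{r : Fin (n+1)} (r·ν r/μ)·TP[0, r, μ/r](h)` for every `h ≤ n` — a mixture of the blocks
`{0, r; μ/r}` (size `r`, gate `μ/r`), each of credit `μ`. [this work] -/
theorem twoPoint_sizeBiased (ν : ℕ → ℝ) (n : ℕ) (hν : ∑ h ∈ Finset.range (n + 1), ν h = 1) (μ : ℝ)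
    (hμ : μ = ∑ r ∈ Finset.range (n + 1), (r : ℝ) * ν r) (hμ0 : μ ≠ 0) (h : ℕ) (hh : h ≤ n) :
    ν h = ∑ r : Fin (n + 1), (((r : ℕ) : ℝ) * ν r / μ) * TP[0, (r : ℕ), μ / (r : ℕ), h] := by
  by_cases h0 : h = 0
  · subst h0
    -- at `h = 0`: component `r ≥ 1` contributes `r ν r/μ − ν r`, component `0` contributes `0`
    have hterm : ∀ r ∈ Finset.range (n + 1), (((r : ℕ) : ℝ) * ν r / μ) * TP[0, (r : ℕ), μ / (r : ℕ), 0] =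
        ((r : ℝ) * ν r / μ - ν r) + (if r = 0 then ν r else 0) := by
      intro r _
      rcases Nat.eq_zero_or_pos r with rfl | hr
      · simp
      · have hr' : (r : ℝ) ≠ 0 := by positivity
        rw [if_neg (by omega : ¬ (0 = r)), if_pos rfl, if_neg (by omega : r ≠ 0)]
        field_simp
        ring
    rw [Fin.sum_univ_eq_sum_range (fun r => (((r : ℕ) : ℝ) * ν r / μ) * TP[0, (r : ℕ), μ / (r : ℕ), 0]) (n + 1),
      Finset.sum_congr rfl hterm, Finset.sum_add_distrib, Finset.sum_sub_distrib, Finset.sum_ite_eq' (Finset.range (n + 1)),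
      if_pos (Finset.mem_range.2 (Nat.succ_pos n)), ← Finset.sum_div, ← hμ, div_self hμ0, hν]
    ring
  · -- at `h ≥ 1`: only the component `r = h` contributes
    rw [Finset.sum_eq_single (⟨h, Nat.lt_succ_of_le hh⟩ : Fin (n + 1))]
    · have hh' : (h : ℝ) ≠ 0 := Nat.cast_ne_zero.2 h0
      show ν h = ((h : ℕ) : ℝ) * ν h / μ *
        (μ / (h : ℕ) * (if h = h then (1 : ℝ) else 0) + (1 - μ / (h : ℕ)) * (if h = 0 then (1 : ℝ) else 0))
      rw [if_pos rfl, if_neg h0, mul_one, mul_zero, add_zero]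
      field_simp
    · intro r _ hr
      have hrh : ¬ (h = (r : ℕ)) := fun e => hr (Fin.ext e.symm)
      rw [if_neg hrh, if_neg h0, mul_zero, mul_zero, add_zero, mul_zero]
    · intro hnot; exact absurd (Finset.mem_univ _) hnot

end RootDec

end Quant

end Summit.CriticalPhenomena.PercolationContinuityZ3.Theorems
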